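import Literature.MathematicalPhysics.QuantumFieldTheory.Balaban1983to89.B8Eq138LandauZd
import Literature.MathematicalPhysics.QuantumFieldTheory.Balaban1983to89.B7Eq214FlatQprime

/-!
# `Balaban1983to89.B8Eq191FlatStencils` — [Balaban1985RegularSpaces] (1.91) p. 91 ∕ (1.95) p. 92 AT THE FLAT BACKGROUND `U₀ = 1`:
# the operators `Δ`, `Q′_j`, `Q′ᵀ`, `Q′ᵀaQ′` of the Dirichlet operator `Δ + Q′ᵀaQ′` of (1.91) read as FINITE REAL STENCILS on `ℤᵈ`,
# and the KERNEL FORM of the compressed flat operator on functions supported in a finite region `Ω₀`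

statement-level skeleton of published theorems with citation tags; proofs where landed; nothing here is a claim about the
Yang–Mills mass gap

T. Bałaban, *Spaces of regular gauge field configurations on a lattice and gauge fixing conditions*, Commun. Math. Phys. **99**
(1985) 75–102 `[Balaban1985RegularSpaces]` ("B8"), (1.91) p. 91 («`H′ = G′²Q′*(Q′G′²Q′*)⁻¹`, `G′ = (Δ + Q′*aQ′)⁻¹`»), (1.95) p. 92,
(1.101) p. 93; [4] = T. Bałaban, *Propagators for lattice gauge theories in a background field*, Commun. Math. Phys. **99** (1985)
389–434 `[Balaban1985BackgroundPropagators]`, (3.19) p. 393, (3.23)–(3.25) p. 394 («We will use only Dirichlet boundary conditions …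
the operator `Δ′_a` with Dirichlet boundary conditions on `∂Ω₀`, i.e. the operator `Δ′_a↾Ω₀ = Ω₀Δ′_aΩ₀`»); [B6] = T. Bałaban, *Propagators
and renormalization transformations for lattice gauge theories. II*, Commun. Math. Phys. **96** (1984) 223–250, p. 235.
PDF held: `paper:balaban1985-cmp99-regular-spaces-gauge-fixing` (journal page = PDF page + 74).

CITATION HEADER (lean-in-tree rule).  Cell `pub-ymgap` (YM Track A, HUMAN RULING D-0062), DAG node N05 = [B8], seat `pub-ymgap-dag-n05-e`
(g3; director-ym R141 (C), FAN-OUT §N05 row s3b successor — THE FLAT CURRENCY for Proposition 6).  WHY: the N05 knit's letters socket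
`B8SockLettersRD.SockLettersRD` (and the per-datum JOIN `B8SockHFPRD.sockHFP_body_of_join_RD`) display [4]'s operators `G′, Δ, Q′, Q′ᵀ, 𝔄, C, H′`
as LETTERS with laws; at a finite-`Ω₀` member (the cube family `{□_j}` of (1.131), Proposition 6 p. 99) and at the flat datum `(1, U₀″)` that
Proposition 6 uses, every such operator is a FINITE REAL STENCIL on `ℤᵈ`: `R(1) = id`, the level transporters `bgT L 1` are `1`
(`B8Eq119TwistedAxial.bgT_one`), `Q′_j` is the plain block mean (`B7Eq214FlatQprime.QprimeIter_one_eq_sum_blockSites`).  THIS FILE proves the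
flat readings needed to CONSTRUCT `G′(1) = (Δ_{Ω₀} + Q′ᵀaQ′)⁻¹` by linear algebra (companion module `B8Eq191FlatGreenDirichlet`):
* §1 `conjR` at the unit, the flat covariant derivatives and the flat Laplacian `covLap η 1` as the `η⁻²`-weighted second-difference
  stencil (`covLap_flat_apply`);
* §2 expansion of a function supported in a finite set `S` over `S` (`apply_eq_sum_ite_smul_of_supp`) and the KERNEL FORM of the flat
  Laplacian on `S`-supported functions (`covLap_flat_eq_sum_of_supp`);
* §3 the flat transposes `qprimeT1 ∕ QprimeT ∕ QT` at `U₀ = 1` (`QprimeT_flat_apply`: `(Q′_jᵀν)(x) = L^{−dj}ν(y_j(x))`, `y_j(x)` the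
  `Lʲ`-block of `x`; `QT_flat_apply`), the flat `Q′_j` on `S`-supported functions as a sum over `S` (`QprimeIter_flat_eq_sum_of_supp`);
* §4 the kernel form of `Q′ᵀaQ′` (`QTaQ_flat_eq_sum_of_supp`) and of the whole flat operator `Δ + Q′ᵀaQ′` on `S`-supported functions
  (`flatDirichletOp_eq_sum_of_supp`): `(Δh + Q′ᵀaQ′h)(x) = Σ_{z∈S} K(x, z)•h(z)` with the explicit symmetric real kernel
  `K = η⁻²·(2d·δ − nearest neighbours) + Σ_j a_j L^{−2dj}·[same Λ_j-block]`.

HONEST SCOPE.  Finite bookkeeping of the tree's concrete definitions at the flat background; no estimate; nothing of [4] ∕ [B6] asserted.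
Count-neutral; N05 NOT discharged; one finite `T⁴` programme at fixed `ε`, Bałaban as printed; nothing continuum ∕ ℝ⁴ ∕ OS ∕ mass-gap ∕ Clay.
No `sorry`, no `def`, no `instance`, no `notation`.  Unit `pub-ymgap-dag-n05-e` (g3), 2026-08-27.
-/

noncomputable section

namespace Literature.MathematicalPhysics.QuantumFieldTheory.Balaban1983to89.B8Eq191FlatStencils

open Finset
open B7Prop1Explicit (e)
open B7Eq78Linearization (conjR conjR_apply QprimeIter QprimeIter_zero zdBlocking)
open B8Ineq132 (covDeriv covDerivFwd)
open B8Eq119TwistedAxial (bgT bgT_one)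
open B8Eq138LandauZd (covDivB covLap qprimeT1 QprimeT QT)
open Literature.MathematicalPhysics.QuantumLattice (blockMap blockSites mem_blockSites_iff blockMap_one)
open B7BlockGeometry (blockMap_blockMap)
open B7Eq214FlatQprime (QprimeIter_one_eq_sum_blockSites)

variable {d : ℕ}

/-! ## §1 The flat covariant derivatives and the flat Laplacian -/

section Flat

variable {𝔸 : Type*} [NormedRing 𝔸] [NormedAlgebra ℂ 𝔸]

omit [NormedAlgebra ℂ 𝔸] in
/-- `R(1)Y = Y`. [folklore] [cite: Balaban1985Averaging, (56) p.27] -/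
theorem conjR_unitOne (Y : 𝔸) : conjR (1 : 𝔸ˣ) Y = Y := by
  simp [conjR_apply]

omit [NormedAlgebra ℂ 𝔸] in
/-- `R(1⁻¹)Y = Y`. [folklore] [cite: Balaban1985Averaging, (56) p.27] -/
theorem conjR_unitOne_inv (Y : 𝔸) : conjR (1 : 𝔸ˣ)⁻¹ Y = Y := by
  simp [conjR_apply]

/-- **(1.1)₁ at `U = 1`**: `(D^η_{1,μ}F)(x) = η⁻¹(F(x + e_μ) − F(x))`. [cite: Balaban1985RegularSpaces, (1.1) p.76] -/
theorem covDerivFwd_flat_apply (η : ℝ) (μ : Fin d) (F : (Fin d → ℤ) → 𝔸) (x : (Fin d → ℤ)) :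
    covDerivFwd η (1 : (Fin d → ℤ) → Fin d → 𝔸ˣ) μ F x = η⁻¹ • (F (x + e μ) - F x) := by
  simp [covDerivFwd, conjR_apply]

/-- **(1.1)₂ at `U = 1`**: `(D^{η*}_{1,ν}F)(x) = η⁻¹(F(x − e_ν) − F(x))`. [cite: Balaban1985RegularSpaces, (1.1) p.76] -/
theorem covDeriv_flat_apply (η : ℝ) (ν : Fin d) (F : (Fin d → ℤ) → 𝔸) (x : (Fin d → ℤ)) :
    covDeriv η (1 : (Fin d → ℤ) → Fin d → 𝔸ˣ) ν F x = η⁻¹ • (F (x - e ν) - F x) := by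
  simp [covDeriv, conjR_apply]

/-- **[4] (3.23) at `U = 1`**: the flat Laplacian `Δ^η_1 = D^{η*}_1D^η_1` is the `η⁻²`-weighted second-difference stencil
`(Δ^η_1 f)(x) = η⁻²Σ_μ(2f(x) − f(x + e_μ) − f(x − e_μ))` (the POSITIVE operator `−Δ` in the analysts' sign).
[cite: Balaban1985BackgroundPropagators, (3.23) p.394; Balaban1985RegularSpaces, (1.1) p.76] -/
theorem covLap_flat_apply (η : ℝ) (f : (Fin d → ℤ) → 𝔸) (x : (Fin d → ℤ)) :
    covLap η (1 : (Fin d → ℤ) → Fin d → 𝔸ˣ) f x =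
      ∑ μ : Fin d, (η ^ 2)⁻¹ • ((2 : ℝ) • f x - f (x + e μ) - f (x - e μ)) := by
  unfold covLap covDivB
  refine Finset.sum_congr rfl fun μ _ => ?_
  simp only [covDeriv_flat_apply, covDerivFwd_flat_apply, sub_add_cancel]
  rw [← smul_sub, smul_smul, show η⁻¹ * η⁻¹ = (η ^ 2)⁻¹ by rw [pow_two, mul_inv], two_smul]
  congr 1
  abel

/-! ## §2 Functions supported in a finite set: expansion over the set and the kernel form of the flat Laplacian -/

/-- A function vanishing off a finite set `S` is the `S`-sum of its values against Kronecker deltas (real coefficients).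
[folklore] [cite: Balaban1985BackgroundPropagators, (3.24) p.394 («Ω₀ denotes a characteristic function of Ω₀»)] -/
theorem sum_ite_smul_eq_apply (S : Finset ((Fin d → ℤ))) (h : (Fin d → ℤ) → 𝔸) (hs : ∀ w, w ∉ S → h w = 0) (w : (Fin d → ℤ)) :
    ∑ z ∈ S, (if z = w then (1 : ℝ) else 0) • h z = h w := by
  by_cases hw : w ∈ S
  · rw [Finset.sum_eq_single_of_mem w hw (fun z _ hz => by rw [if_neg hz, zero_smul]), if_pos rfl, one_smul]
  · rw [hs w hw]
    exact Finset.sum_eq_zero fun z hz => by rw [if_neg (fun heq : z = w => hw (heq ▸ hz)), zero_smul]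

/-- The same expansion read from right to left. [folklore] [cite: Balaban1985BackgroundPropagators, (3.24) p.394] -/
theorem apply_eq_sum_ite_smul_of_supp (S : Finset ((Fin d → ℤ))) (h : (Fin d → ℤ) → 𝔸) (hs : ∀ w, w ∉ S → h w = 0) (w : (Fin d → ℤ)) :
    h w = ∑ z ∈ S, (if z = w then (1 : ℝ) else 0) • h z :=
  (sum_ite_smul_eq_apply S h hs w).symm

/-- A real-weighted Kronecker sum: `Σ_{z∈S} (c·[z = w])•h z = c•h w` for `h` vanishing off `S`. [folklore]
[cite: Balaban1985BackgroundPropagators, (3.24) p.394] -/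
theorem sum_mul_ite_smul_eq (S : Finset ((Fin d → ℤ))) (h : (Fin d → ℤ) → 𝔸) (hs : ∀ w, w ∉ S → h w = 0) (c : ℝ) (w : (Fin d → ℤ)) :
    ∑ z ∈ S, (c * (if z = w then (1 : ℝ) else 0)) • h z = c • h w := by
  simp_rw [mul_smul, ← Finset.smul_sum]
  rw [sum_ite_smul_eq_apply S h hs w]

/-- **THE KERNEL FORM OF THE FLAT LAPLACIAN on functions supported in a finite set `S`** (any `x ∈ ℤᵈ`):
`(Δ^η_1 h)(x) = Σ_{z∈S} K_Δ(x, z)•h(z)`, `K_Δ(x, z) = η⁻²Σ_μ(2[z = x] − [z = x + e_μ] − [z = x − e_μ])` — the Dirichlet Laplacian's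
matrix when read at `x ∈ S`. [cite: Balaban1985BackgroundPropagators, (3.23)–(3.24) p.394] -/
theorem covLap_flat_eq_sum_of_supp (η : ℝ) (S : Finset ((Fin d → ℤ))) (h : (Fin d → ℤ) → 𝔸) (hs : ∀ w, w ∉ S → h w = 0) (x : (Fin d → ℤ)) :
    covLap η (1 : (Fin d → ℤ) → Fin d → 𝔸ˣ) h x =
      ∑ z ∈ S, ((η ^ 2)⁻¹ * ∑ μ : Fin d, ((2 : ℝ) * (if z = x then (1 : ℝ) else 0) - (if z = x + e μ then (1 : ℝ) else 0)
        - (if z = x - e μ then (1 : ℝ) else 0))) • h z := by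
  rw [covLap_flat_apply]
  have hx2 : (2 : ℝ) • h x = ∑ z ∈ S, ((2 : ℝ) * (if z = x then (1 : ℝ) else 0)) • h z :=
    (sum_mul_ite_smul_eq S h hs 2 x).symm
  have hp : ∀ μ : Fin d, h (x + e μ) = ∑ z ∈ S, (if z = x + e μ then (1 : ℝ) else 0) • h z :=
    fun μ => apply_eq_sum_ite_smul_of_supp S h hs _
  have hm : ∀ μ : Fin d, h (x - e μ) = ∑ z ∈ S, (if z = x - e μ then (1 : ℝ) else 0) • h z :=
    fun μ => apply_eq_sum_ite_smul_of_supp S h hs _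
  calc ∑ μ : Fin d, (η ^ 2)⁻¹ • ((2 : ℝ) • h x - h (x + e μ) - h (x - e μ))
      = ∑ μ : Fin d, ∑ z ∈ S, ((η ^ 2)⁻¹ * ((2 : ℝ) * (if z = x then (1 : ℝ) else 0)
          - (if z = x + e μ then (1 : ℝ) else 0) - (if z = x - e μ then (1 : ℝ) else 0))) • h z := by
        refine Finset.sum_congr rfl fun μ _ => ?_
        rw [hx2, hp μ, hm μ, ← Finset.sum_sub_distrib, ← Finset.sum_sub_distrib, Finset.smul_sum]
        refine Finset.sum_congr rfl fun z _ => ?_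
        rw [← sub_smul, ← sub_smul, smul_smul]
    _ = _ := by
        rw [Finset.sum_comm]
        refine Finset.sum_congr rfl fun z _ => ?_
        rw [← Finset.sum_smul, ← Finset.mul_sum]

/-! ## §3 The flat transposes `Q′ᵀ` and the flat averages `Q′_j` -/

variable [CompleteSpace 𝔸]

/-- One flat transpose step: `(Q′ᵀν)(x) = L⁻ᵈν(y(x))`, `y(x)` the `L`-block of `x` (`R(1) = id`).
[cite: Balaban1985BackgroundPropagators, (3.19) p.393] -/
theorem qprimeT1_flat_apply (L : ℕ) (j : ℕ) (ν : (Fin d → ℤ) → 𝔸) (x : (Fin d → ℤ)) :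
    qprimeT1 L (1 : (Fin d → ℤ) → Fin d → 𝔸ˣ) j ν x = ((L : ℝ) ^ d)⁻¹ • ν (blockMap L x) := by
  unfold qprimeT1
  rw [bgT_one]
  simp [conjR_apply]

/-- **The flat iterated transpose**: `(Q′_jᵀν)(x) = L^{−dj}ν(y_j(x))`, `y_j(x) = blockMap (Lʲ) x` the `Lʲ`-block of `x` (nested blocks).
[cite: Balaban1985BackgroundPropagators, (3.19) p.393; Balaban1985Averaging, (3) p.17] -/
theorem QprimeT_flat_apply (L : ℕ) :
    ∀ (j : ℕ) (ν : (Fin d → ℤ) → 𝔸) (x : (Fin d → ℤ)),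
      QprimeT L (1 : (Fin d → ℤ) → Fin d → 𝔸ˣ) j ν x = (((L : ℝ) ^ d)⁻¹) ^ j • ν (blockMap (L ^ j) x) := by
  intro j
  induction j with
  | zero =>
    intro ν x
    show ν x = _
    rw [pow_zero, one_smul, pow_zero, blockMap_one]
  | succ j ih =>
    intro ν x
    show QprimeT L (1 : (Fin d → ℤ) → Fin d → 𝔸ˣ) j (qprimeT1 L 1 j ν) x = _
    rw [ih, qprimeT1_flat_apply, smul_smul, ← pow_succ, blockMap_blockMap, ← pow_succ]

/-- **The flat `Q′ᵀ` on a multiplier**: `(Q′(1)ᵀμ)(x) = Σ_{j ≤ m} L^{−dj}·(𝟙_{Λ_j}μ_j)(y_j(x))`.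
[cite: Balaban1985BackgroundPropagators, (3.24) p.394; Balaban1985RegularSpaces, (1.29) p.81] -/
theorem QT_flat_apply (L m : ℕ) (Λs : ℕ → Set ((Fin d → ℤ))) (μ : ℕ → (Fin d → ℤ) → 𝔸) (x : (Fin d → ℤ)) :
    QT L m Λs (1 : (Fin d → ℤ) → Fin d → 𝔸ˣ) μ x =
      ∑ j ∈ Finset.range (m + 1), (((L : ℝ) ^ d)⁻¹) ^ j • (Λs j).indicator (μ j) (blockMap (L ^ j) x) := by
  unfold QT
  exact Finset.sum_congr rfl fun j _ => QprimeT_flat_apply L j _ x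

/-- `L^{−jd} = (L^{−d})ʲ`. [folklore] [cite: Balaban1985Averaging, (3) p.17] -/
theorem inv_pow_mul_eq (L j : ℕ) : (((L : ℝ) ^ (j * d))⁻¹) = (((L : ℝ) ^ d)⁻¹) ^ j := by
  rw [mul_comm, pow_mul, inv_pow]

/-- **The flat average `Q′_j` of a function supported in a finite set `S`, as a sum over `S`** (any `y ∈ ℤᵈ`):
`(Q′_j(1)h)(y) = Σ_{z∈S} L^{−dj}[y_j(z) = y]•h(z)`. [cite: Balaban1985BackgroundPropagators, (3.19) p.393; Balaban1985Averaging, (212) p.50] -/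
theorem QprimeIter_flat_eq_sum_of_supp {L : ℕ} (hL : 1 ≤ L) (S : Finset ((Fin d → ℤ))) (h : (Fin d → ℤ) → 𝔸)
    (hs : ∀ w, w ∉ S → h w = 0) (j : ℕ) (y : (Fin d → ℤ)) :
    QprimeIter (zdBlocking d L) (bgT L (1 : (Fin d → ℤ) → Fin d → 𝔸ˣ)) j h y =
      ∑ z ∈ S, (if blockMap (L ^ j) z = y then (((L : ℝ) ^ d)⁻¹) ^ j else 0) • h z := by
  have hL0 : 0 < L := hL
  haveI : NeZero (L ^ j) := ⟨(pow_pos hL0 j).ne'⟩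
  rw [bgT_one, QprimeIter_one_eq_sum_blockSites hL h j y, inv_pow_mul_eq]
  have h1 : ∑ x ∈ blockSites (L ^ j) y, ((((L : ℝ) ^ d)⁻¹) ^ j) • h x =
      ∑ x ∈ (blockSites (L ^ j) y).filter (fun x => x ∈ S), ((((L : ℝ) ^ d)⁻¹) ^ j) • h x := by
    rw [Finset.sum_filter]
    refine Finset.sum_congr rfl fun x _ => ?_
    by_cases hx : x ∈ S
    · rw [if_pos hx]
    · rw [if_neg hx, hs x hx, smul_zero]
  have h2 : ∑ z ∈ S, (if blockMap (L ^ j) z = y then (((L : ℝ) ^ d)⁻¹) ^ j else 0) • h z =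
      ∑ z ∈ S.filter (fun z => blockMap (L ^ j) z = y), ((((L : ℝ) ^ d)⁻¹) ^ j) • h z := by
    rw [Finset.sum_filter]
    refine Finset.sum_congr rfl fun z _ => ?_
    split_ifs <;> simp
  have h3 : (blockSites (L ^ j) y).filter (fun x => x ∈ S) = S.filter (fun z => blockMap (L ^ j) z = y) := by
    ext z
    simp only [Finset.mem_filter, mem_blockSites_iff]
    tauto
  rw [h1, h2, h3]

/-! ## §4 The kernel form of `Q′ᵀaQ′` and of the flat Dirichlet operator `Δ + Q′ᵀaQ′` on `S`-supported functions -/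

open Classical in
/-- **The kernel form of `Q′(1)ᵀaQ′(1)` on `S`-supported functions** (`a = (a_j)` real level weights, `Q′` read on the structure
`{Λ_j}_{j ≤ m}` and zero elsewhere): `(Q′ᵀaQ′h)(x) = Σ_{z∈S} K_Q(x, z)•h(z)`,
`K_Q(x, z) = Σ_{j ≤ m} a_j L^{−2dj}[y_j(x) ∈ Λ_j ∧ y_j(z) = y_j(x)]` — a Gram kernel.
[cite: Balaban1985BackgroundPropagators, (3.24) p.394, (3.19) p.393; Balaban1985RegularSpaces, (1.91) p.91] -/
theorem QTaQ_flat_eq_sum_of_supp {L : ℕ} (hL : 1 ≤ L) (m : ℕ) (Λs : ℕ → Set ((Fin d → ℤ))) (a : ℕ → ℝ) (S : Finset ((Fin d → ℤ)))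
    (h : (Fin d → ℤ) → 𝔸) (hs : ∀ w, w ∉ S → h w = 0) (x : (Fin d → ℤ)) :
    QT L m Λs (1 : (Fin d → ℤ) → Fin d → 𝔸ˣ)
        (fun j w => a j • (if j ≤ m then (Λs j).indicator (QprimeIter (zdBlocking d L) (bgT L (1 : (Fin d → ℤ) → Fin d → 𝔸ˣ)) j h) w
          else 0)) x =
      ∑ z ∈ S, (∑ j ∈ Finset.range (m + 1), (if blockMap (L ^ j) x ∈ Λs j ∧ blockMap (L ^ j) z = blockMap (L ^ j) x then
        a j * ((((L : ℝ) ^ d)⁻¹) ^ j) ^ 2 else 0)) • h z := by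
  classical
  rw [QT_flat_apply]
  have hterm : ∀ j ∈ Finset.range (m + 1),
      (((L : ℝ) ^ d)⁻¹) ^ j • (Λs j).indicator (fun w => a j • (if j ≤ m then
        (Λs j).indicator (QprimeIter (zdBlocking d L) (bgT L (1 : (Fin d → ℤ) → Fin d → 𝔸ˣ)) j h) w else 0)) (blockMap (L ^ j) x) =
      ∑ z ∈ S, (if blockMap (L ^ j) x ∈ Λs j ∧ blockMap (L ^ j) z = blockMap (L ^ j) x then
        a j * ((((L : ℝ) ^ d)⁻¹) ^ j) ^ 2 else 0) • h z := by
    intro j hj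
    have hjm : j ≤ m := Nat.lt_succ_iff.mp (Finset.mem_range.mp hj)
    by_cases hin : blockMap (L ^ j) x ∈ Λs j
    · rw [Set.indicator_of_mem hin, if_pos hjm, Set.indicator_of_mem hin, QprimeIter_flat_eq_sum_of_supp hL S h hs j,
        Finset.smul_sum, Finset.smul_sum]
      refine Finset.sum_congr rfl fun z _ => ?_
      rw [smul_smul, smul_smul]
      congr 1
      by_cases hz : blockMap (L ^ j) z = blockMap (L ^ j) x
      · rw [if_pos hz, if_pos ⟨hin, hz⟩]; ring
      · rw [if_neg hz, if_neg (fun h => hz h.2)]; ring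
    · rw [Set.indicator_of_notMem hin, smul_zero]
      symm
      exact Finset.sum_eq_zero fun z _ => by rw [if_neg (fun h => hin h.1), zero_smul]
  rw [Finset.sum_congr rfl hterm, Finset.sum_comm]
  refine Finset.sum_congr rfl fun z _ => ?_
  rw [Finset.sum_smul]

open Classical in
/-- **THE KERNEL FORM OF THE FLAT DIRICHLET OPERATOR `Δ + Q′ᵀaQ′` OF (1.91) ∕ (1.95) AT `U₀ = 1` on functions supported in a finite
set `S`** (read at any `x ∈ ℤᵈ`; for `x ∈ S` this is the matrix of the compression `SΔ′_aS` of [4] p. 394):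
`((Δ + Q′ᵀaQ′)h)(x) = Σ_{z∈S} K(x, z)•h(z)`, `K = K_Δ + K_Q` real and symmetric.
[cite: Balaban1985RegularSpaces, (1.91) p.91, (1.95) p.92; Balaban1985BackgroundPropagators, (3.23)–(3.25) p.394] -/
theorem flatDirichletOp_eq_sum_of_supp (η : ℝ) {L : ℕ} (hL : 1 ≤ L) (m : ℕ) (Λs : ℕ → Set ((Fin d → ℤ))) (a : ℕ → ℝ)
    (S : Finset ((Fin d → ℤ))) (h : (Fin d → ℤ) → 𝔸) (hs : ∀ w, w ∉ S → h w = 0) (x : (Fin d → ℤ)) :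
    covLap η (1 : (Fin d → ℤ) → Fin d → 𝔸ˣ) h x + QT L m Λs (1 : (Fin d → ℤ) → Fin d → 𝔸ˣ)
        (fun j w => a j • (if j ≤ m then (Λs j).indicator (QprimeIter (zdBlocking d L) (bgT L (1 : (Fin d → ℤ) → Fin d → 𝔸ˣ)) j h) w
          else 0)) x =
      ∑ z ∈ S, (((η ^ 2)⁻¹ * ∑ μ : Fin d, ((2 : ℝ) * (if z = x then (1 : ℝ) else 0) - (if z = x + e μ then (1 : ℝ) else 0)
        - (if z = x - e μ then (1 : ℝ) else 0))) +
        (∑ j ∈ Finset.range (m + 1), (if blockMap (L ^ j) x ∈ Λs j ∧ blockMap (L ^ j) z = blockMap (L ^ j) x then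
          a j * ((((L : ℝ) ^ d)⁻¹) ^ j) ^ 2 else 0))) • h z := by
  classical
  rw [covLap_flat_eq_sum_of_supp η S h hs x, QTaQ_flat_eq_sum_of_supp hL m Λs a S h hs x, ← Finset.sum_add_distrib]
  exact Finset.sum_congr rfl fun z _ => (add_smul _ _ _).symm

end Flat

end Literature.MathematicalPhysics.QuantumFieldTheory.Balaban1983to89.B8Eq191FlatStencils

end
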